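import Literature.Geometry.Lorentzian.KerrRadiusHessianChart
import Literature.Geometry.Lorentzian.KerrRadiusHessianIdentity
import HarnessLib

/-!
# Null pseudo-convexity of the Kerr cylinders in Kerr–Schild coordinates, axis included

(family `gr`; namespace `Literature.Geometry.Lorentzian.Kerr`; sequel to
`KerrRadiusPseudoconvexity.lean`, `KerrRadiusHessianChart.lean`, `KerrRadiusHessianIdentity.lean`.)

The pseudo-convexity dichotomy of the Kerr radius level sets, so far proved at the points covered
by the ingoing Kerr chart (off the symmetry axis), is extended to ALL points of the Kerr–Schild
chart domain:

* `Kerr.delta_mul_hessAt_radius_eq` — the tangency-free radial-acceleration identity of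
  `KerrRadiusHessianIdentity.lean`, written entirely in Kerr–Schild Cartesian quantities
  (`Kerr.bilin`, `Kerr.radius`, `Kerr.blSigma ∘ spatial`, `Kerr.ksEnergy`, `Kerr.ksAngMom`), holds
  at EVERY point with `r > 0`: off the axis by transport through the chart
  (`delta_mul_hessAt_radius_eq_of_offAxis`), on the axis because both sides are continuous in the
  point and the off-axis points are dense (`Kerr.eqOn_region_of_offAxis`);
* on a null vector tangent to the cylinder this reads `2Σ² Hess r(w,w) = R′(r; E, L, Q)` with
  `R(r; E, L, Q) = 0`, `Q = Kerr.ksCarterQ` (`two_mul_sq_blSigma_mul_hessAt_eq_deriv`);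
* on the axis a non-zero null tangent vector has `E ≠ 0` and `L = 0`
  (`ksEnergy_ne_zero_of_axis`, `ksAngMom_of_axis`), so its constants are Θ-admissible and
  non-trivial there as well;
* **main theorems** `Kerr.hessAt_radius_neg`, `Kerr.hessAt_radius_pos`: in sub-extremal Kerr, at
  every point `z` of Kerr–Schild coordinate space with `r₊ < r(z) < r_ph⁺` (resp. `r(z) > r_ph⁻`),
  every non-zero vector null for `g_{M,a}` and tangent to `{r = r(z)}` has `Hess r(w,w) < 0`
  (resp. `> 0`) — Ionescu–Klainerman's strong null pseudo-convexity of the cylinders towards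
  `{r < c}` below the prograde photon orbit and towards `{r > c}` beyond the retrograde one
  (Ionescu–Klainerman, JAMS 26 (2013), Def. 1.1), with no exceptional points.

## References

* B. Carter, Comm. Math. Phys. 10 (1968) 280–310, §4.
* A. D. Ionescu, S. Klainerman, J. Amer. Math. Soc. 26 (2013) 563–593, Def. 1.1, Thm. 1.2.
-/

noncomputable section

set_option maxSynthPendingDepth 3

open Set Function Module Real
open scoped Topology ContDiff
open Literature.Geometry.Lorentzian.MetricCoord

namespace Literature.Geometry.Lorentzian

namespace Kerr

variable {M a : ℝ}

/-! ### The identity in Kerr–Schild coordinates, off the axis -/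

/-- **The radial-acceleration identity in Kerr–Schild Cartesian coordinates, off the axis.** At a
point `z` with `r > 0` and `x ≠ 0 ∨ y ≠ 0`, for every vector `w`, with `r = Kerr.radius a z`,
`Σ = blSigma a x⃗`, `E = ksEnergy`, `L = ksAngMom`, `P = E(r² + a²) − aL`, `g = g_z(w,w)`,
`ρ = dr_z(w)`, `σ = dΣ_z(w)`:
`Δ · 2Σ² Hess r_z(w,w) = Δ(4ErP + 2(2r³ − 3Mr² + a²r + (Σ − r²)(r − M)) g − 2Σρσ) − (2r − 2M)(P² − Σ²ρ² + ΣΔ g)`.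
Transport of `Kerr.Ingoing.delta_mul_two_mul_sq_sigma_mul_hessR` through the chart dictionary.
[cite: Carter1968, §4] -/
theorem delta_mul_hessAt_radius_eq_of_offAxis {z : E4} (hz : 0 < radius a z)
    (hoff : z 1 ≠ 0 ∨ z 2 ≠ 0) (w : E4) :
    (radius a z ^ 2 - 2 * M * radius a z + a ^ 2) *
        (2 * blSigma a (E4.spatial z) ^ 2 * hessAt (Kerr.bilin M a) (radius a) z w w) =
      (radius a z ^ 2 - 2 * M * radius a z + a ^ 2) *
          (4 * ksEnergy M a z w * radius a z *
              (ksEnergy M a z w * (radius a z ^ 2 + a ^ 2) - a * ksAngMom M a z w) +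
            2 * (2 * radius a z ^ 3 - 3 * M * radius a z ^ 2 + a ^ 2 * radius a z +
                (blSigma a (E4.spatial z) - radius a z ^ 2) * (radius a z - M)) *
              Kerr.bilin M a z w w -
            2 * blSigma a (E4.spatial z) * fderiv ℝ (radius a) z w *
              fderiv ℝ (fun z : E4 ↦ blSigma a (E4.spatial z)) z w) -
        (2 * radius a z - 2 * M) *
          ((ksEnergy M a z w * (radius a z ^ 2 + a ^ 2) - a * ksAngMom M a z w) ^ 2 -
            blSigma a (E4.spatial z) ^ 2 * fderiv ℝ (radius a) z w ^ 2 +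
            blSigma a (E4.spatial z) * (radius a z ^ 2 - 2 * M * radius a z + a ^ 2) *
              Kerr.bilin M a z w w) := by
  have hzr : z ∈ region a 0 := by rw [mem_region, max_self]; exact hz
  obtain ⟨u, hu, rfl⟩ := Ingoing.exists_chartFun_eq (a := a) (r₀ := 0) hzr hoff
  obtain ⟨v, rfl⟩ := Ingoing.jac_surjective (a := a) hu w
  have hreg : u ∈ Ingoing.regularSet a := Ingoing.mem_regularSet_of_mem_coordDomain hu
  rw [Ingoing.hessAt_bilin_radius_chartFun_self hu, Ingoing.ksEnergy_chartFun_jac hu,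
    Ingoing.ksAngMom_chartFun_jac hu, Ingoing.kerrBilin_jac hu, Ingoing.fderiv_radius_chartFun_jac hu,
    Ingoing.fderiv_blSigma_spatial_chartFun_jac hu, Ingoing.blSigma_spatial_chartFun hu,
    Ingoing.radius_chartFun_of_mem a hu]
  have H := Ingoing.delta_mul_two_mul_sq_sigma_mul_hessR (M := M) hreg v
  simp only [Ingoing.sigma] at H ⊢
  linear_combination H

/-! ### The identity at every point (axis by continuity) -/

/-- **The radial-acceleration identity in Kerr–Schild coordinates at EVERY point with `r > 0`**
(axis included): both sides are continuous functions of the point on `Kerr.region a 0` and agree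
off the axis, which is dense (`Kerr.eqOn_region_of_offAxis`). [cite: Carter1968, §4] -/
theorem delta_mul_hessAt_radius_eq {z : E4} (hz : 0 < radius a z) (w : E4) :
    (radius a z ^ 2 - 2 * M * radius a z + a ^ 2) *
        (2 * blSigma a (E4.spatial z) ^ 2 * hessAt (Kerr.bilin M a) (radius a) z w w) =
      (radius a z ^ 2 - 2 * M * radius a z + a ^ 2) *
          (4 * ksEnergy M a z w * radius a z *
              (ksEnergy M a z w * (radius a z ^ 2 + a ^ 2) - a * ksAngMom M a z w) +
            2 * (2 * radius a z ^ 3 - 3 * M * radius a z ^ 2 + a ^ 2 * radius a z +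
                (blSigma a (E4.spatial z) - radius a z ^ 2) * (radius a z - M)) *
              Kerr.bilin M a z w w -
            2 * blSigma a (E4.spatial z) * fderiv ℝ (radius a) z w *
              fderiv ℝ (fun z : E4 ↦ blSigma a (E4.spatial z)) z w) -
        (2 * radius a z - 2 * M) *
          ((ksEnergy M a z w * (radius a z ^ 2 + a ^ 2) - a * ksAngMom M a z w) ^ 2 -
            blSigma a (E4.spatial z) ^ 2 * fderiv ℝ (radius a) z w ^ 2 +
            blSigma a (E4.spatial z) * (radius a z ^ 2 - 2 * M * radius a z + a ^ 2) *
              Kerr.bilin M a z w w) := by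
  -- the difference of the two sides as a function of the point
  set G : E4 → ℝ := fun z ↦
    (radius a z ^ 2 - 2 * M * radius a z + a ^ 2) *
        (2 * blSigma a (E4.spatial z) ^ 2 * hessAt (Kerr.bilin M a) (radius a) z w w) -
      ((radius a z ^ 2 - 2 * M * radius a z + a ^ 2) *
          (4 * ksEnergy M a z w * radius a z *
              (ksEnergy M a z w * (radius a z ^ 2 + a ^ 2) - a * ksAngMom M a z w) +
            2 * (2 * radius a z ^ 3 - 3 * M * radius a z ^ 2 + a ^ 2 * radius a z +
                (blSigma a (E4.spatial z) - radius a z ^ 2) * (radius a z - M)) *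
              Kerr.bilin M a z w w -
            2 * blSigma a (E4.spatial z) * fderiv ℝ (radius a) z w *
              fderiv ℝ (fun z : E4 ↦ blSigma a (E4.spatial z)) z w) -
        (2 * radius a z - 2 * M) *
          ((ksEnergy M a z w * (radius a z ^ 2 + a ^ 2) - a * ksAngMom M a z w) ^ 2 -
            blSigma a (E4.spatial z) ^ 2 * fderiv ℝ (radius a) z w ^ 2 +
            blSigma a (E4.spatial z) * (radius a z ^ 2 - 2 * M * radius a z + a ^ 2) *
              Kerr.bilin M a z w w)) with hG
  have hr : ContinuousOn (radius a) (region a 0 : Set E4) := (continuous_radius a).continuousOn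
  have hS := continuousOn_blSigma_spatial a 0
  have hE := continuousOn_ksEnergy M a 0 w
  have hL := continuousOn_ksAngMom M a 0 w
  have hg := continuousOn_bilin_apply M a 0 w w
  have hρ := continuousOn_fderiv_radius_apply a 0 w
  have hσ := continuousOn_fderiv_blSigma_spatial_apply a 0 w
  have hH := continuousOn_hessAt_bilin_radius_apply M a 0 w w
  have hΔc : ContinuousOn (fun z : E4 ↦ radius a z ^ 2 - 2 * M * radius a z + a ^ 2) (region a 0) :=
    ((hr.pow 2).sub (continuousOn_const.mul hr)).add continuousOn_const
  have hP : ContinuousOn (fun z : E4 ↦ ksEnergy M a z w * (radius a z ^ 2 + a ^ 2) -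
      a * ksAngMom M a z w) (region a 0) :=
    (hE.mul ((hr.pow 2).add continuousOn_const)).sub (continuousOn_const.mul hL)
  have hc : ContinuousOn (fun z : E4 ↦ 2 * (2 * radius a z ^ 3 - 3 * M * radius a z ^ 2 +
      a ^ 2 * radius a z + (blSigma a (E4.spatial z) - radius a z ^ 2) * (radius a z - M)))
      (region a 0) :=
    continuousOn_const.mul ((((continuousOn_const.mul (hr.pow 3)).sub
      (continuousOn_const.mul (hr.pow 2))).add (continuousOn_const.mul hr)).add
      ((hS.sub (hr.pow 2)).mul (hr.sub continuousOn_const)))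
  have hLHS : ContinuousOn (fun z : E4 ↦ (radius a z ^ 2 - 2 * M * radius a z + a ^ 2) *
      (2 * blSigma a (E4.spatial z) ^ 2 * hessAt (Kerr.bilin M a) (radius a) z w w)) (region a 0) :=
    hΔc.mul ((continuousOn_const.mul (hS.pow 2)).mul hH)
  have hRHS₁ : ContinuousOn (fun z : E4 ↦ (radius a z ^ 2 - 2 * M * radius a z + a ^ 2) *
      (4 * ksEnergy M a z w * radius a z *
          (ksEnergy M a z w * (radius a z ^ 2 + a ^ 2) - a * ksAngMom M a z w) +
        2 * (2 * radius a z ^ 3 - 3 * M * radius a z ^ 2 + a ^ 2 * radius a z +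
            (blSigma a (E4.spatial z) - radius a z ^ 2) * (radius a z - M)) *
          Kerr.bilin M a z w w -
        2 * blSigma a (E4.spatial z) * fderiv ℝ (radius a) z w *
          fderiv ℝ (fun z : E4 ↦ blSigma a (E4.spatial z)) z w)) (region a 0) :=
    hΔc.mul (((((continuousOn_const.mul hE).mul hr).mul hP).add (hc.mul hg)).sub
      (((continuousOn_const.mul hS).mul hρ).mul hσ))
  have hRHS₂ : ContinuousOn (fun z : E4 ↦ (2 * radius a z - 2 * M) *
      ((ksEnergy M a z w * (radius a z ^ 2 + a ^ 2) - a * ksAngMom M a z w) ^ 2 -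
        blSigma a (E4.spatial z) ^ 2 * fderiv ℝ (radius a) z w ^ 2 +
        blSigma a (E4.spatial z) * (radius a z ^ 2 - 2 * M * radius a z + a ^ 2) *
          Kerr.bilin M a z w w)) (region a 0) :=
    ((continuousOn_const.mul hr).sub continuousOn_const).mul
      (((hP.pow 2).sub ((hS.pow 2).mul (hρ.pow 2))).add ((hS.mul hΔc).mul hg))
  have hcont : ContinuousOn G (region a 0) := by
    rw [hG]
    exact hLHS.sub (hRHS₁.sub hRHS₂)
  have hoff : ∀ y ∈ region a 0, (y 1 ≠ 0 ∨ y 2 ≠ 0) → G y = 0 := fun y hy hax ↦ by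
    rw [hG]
    exact sub_eq_zero.2 (delta_mul_hessAt_radius_eq_of_offAxis (radius_pos_of_mem_region hy) hax w)
  have hz' : z ∈ region a 0 := by rw [mem_region, max_self]; exact hz
  have h0 : G z = 0 := eqOn_region_of_offAxis hcont hoff z hz'
  rw [hG] at h0
  exact sub_eq_zero.1 h0

/-- **On a null vector tangent to the cylinder, `2Σ² Hess r(w,w) = R′(r; E, L, Q)`** with
`Q = Kerr.ksCarterQ` and `R` the null radial Carter potential, at every point of Kerr–Schild
coordinate space off the horizons (`Δ(r) ≠ 0`, `r > 0`), axis included. [cite: Carter1968, §4] -/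
theorem two_mul_sq_blSigma_mul_hessAt_eq_deriv {z : E4} (hz : 0 < radius a z)
    (hΔ : radius a z ^ 2 - 2 * M * radius a z + a ^ 2 ≠ 0) {w : E4}
    (hnull : Kerr.bilin M a z w w = 0) (htan : fderiv ℝ (radius a) z w = 0) :
    2 * blSigma a (E4.spatial z) ^ 2 * hessAt (Kerr.bilin M a) (radius a) z w w =
      deriv (nullRadialPotential M a (ksEnergy M a z w) (ksAngMom M a z w) (ksCarterQ M a z w))
        (radius a z) := by
  have h := delta_mul_hessAt_radius_eq (M := M) hz w
  rw [hnull, htan] at h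
  have h' : (radius a z ^ 2 - 2 * M * radius a z + a ^ 2) *
      (2 * blSigma a (E4.spatial z) ^ 2 * hessAt (Kerr.bilin M a) (radius a) z w w) =
      (radius a z ^ 2 - 2 * M * radius a z + a ^ 2) *
          (4 * ksEnergy M a z w * radius a z *
            (ksEnergy M a z w * (radius a z ^ 2 + a ^ 2) - a * ksAngMom M a z w)) -
        (2 * radius a z - 2 * M) *
          (ksEnergy M a z w * (radius a z ^ 2 + a ^ 2) - a * ksAngMom M a z w) ^ 2 := by
    linear_combination h
  apply mul_left_cancel₀ hΔ
  rw [h', deriv_nullRadialPotential]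
  unfold ksCarterQ
  rw [sub_add_cancel]
  set Δ := radius a z ^ 2 - 2 * M * radius a z + a ^ 2 with hΔdef
  set P := ksEnergy M a z w * (radius a z ^ 2 + a ^ 2) - a * ksAngMom M a z w with hPdef
  have hPΔ : P ^ 2 / Δ * Δ = P ^ 2 := div_mul_cancel₀ _ hΔ
  linear_combination (2 * radius a z - 2 * M) * hPΔ

/-- The null radial Carter potential with `Q = Kerr.ksCarterQ` vanishes at `r(z)` (off the
horizons): `P² − Δ(Q + (L − aE)²) = 0` by the very definition of `ksCarterQ`. [cite: Carter1968, §4] -/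
theorem nullRadialPotential_ksCarterQ_eq_zero {z : E4}
    (hΔ : radius a z ^ 2 - 2 * M * radius a z + a ^ 2 ≠ 0) (w : E4) :
    nullRadialPotential M a (ksEnergy M a z w) (ksAngMom M a z w) (ksCarterQ M a z w)
      (radius a z) = 0 := by
  unfold nullRadialPotential ksCarterQ
  rw [sub_add_cancel]
  set Δ := radius a z ^ 2 - 2 * M * radius a z + a ^ 2 with hΔdef
  set P := ksEnergy M a z w * (radius a z ^ 2 + a ^ 2) - a * ksAngMom M a z w with hPdef
  have hPΔ : P ^ 2 / Δ * Δ = P ^ 2 := div_mul_cancel₀ _ hΔ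
  linear_combination (-1 : ℝ) * hPΔ

/-! ### The axis -/

section Axis

variable {z : E4}

/-- On the axis `x = y = 0` the Kerr–Schild radius is `|z³|`. [folklore] -/
theorem radius_of_axis (h1 : z 1 = 0) (h2 : z 2 = 0) : radius a z = |z 3| := by
  have hsq : radius a z ^ 2 = z 3 ^ 2 := by
    rw [radius_sq, E4.spatialNorm_sq, h1, h2]
    have hd : (0 ^ 2 + 0 ^ 2 + z 3 ^ 2 - a ^ 2) ^ 2 + 4 * a ^ 2 * z 3 ^ 2 = (z 3 ^ 2 + a ^ 2) ^ 2 := by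
      ring
    rw [hd, Real.sqrt_sq (by positivity)]
    ring
  have h := congrArg Real.sqrt hsq
  rwa [Real.sqrt_sq (radius_nonneg a z), Real.sqrt_sq_eq_abs] at h

/-- On the axis, `ℓ(v) = v⁰ + (z³/r) v³`. [folklore] -/
theorem nullCovector_apply_of_axis (h1 : z 1 = 0) (h2 : z 2 = 0) (v : E4) :
    nullCovector a z v = v 0 + z 3 / radius a z * v 3 := by
  simp only [nullCovector, nullCovectorFun, E4.covector_apply, Fin.sum_univ_four, Fin.isValue,
    Matrix.cons_val_zero, Matrix.cons_val_one, Matrix.cons_val, h1, h2]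
  ring

/-- On the axis the axial angular momentum vanishes (`x∂_y − y∂_x = 0` there). [folklore] -/
theorem ksAngMom_of_axis (h1 : z 1 = 0) (h2 : z 2 = 0) (w : E4) : ksAngMom M a z w = 0 := by
  unfold ksAngMom
  rw [E4.axialGenerator_apply, h1, h2, zero_smul, zero_smul, sub_zero, map_zero, zero_apply]

/-- On the axis (with `r > 0`), `dr_z(w) = (z³/r) w³`. [folklore] -/
theorem fderiv_radius_apply_of_axis (hz : 0 < radius a z) (h1 : z 1 = 0) (h2 : z 2 = 0) (w : E4) :
    fderiv ℝ (radius a) z w = z 3 / radius a z * w 3 := by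
  have hr := radius_of_axis (a := a) h1 h2
  have hrsq : radius a z ^ 2 = z 3 ^ 2 := by rw [hr, sq_abs]
  have hS : radius a z ^ 2 * blSigma a (E4.spatial z) = radius a z ^ 4 + a ^ 2 * z 3 ^ 2 :=
    sq_mul_blSigma_spatial a z
  have hSval : blSigma a (E4.spatial z) = radius a z ^ 2 + a ^ 2 := by
    have hr0 : radius a z ^ 2 ≠ 0 := by positivity
    apply mul_left_cancel₀ hr0
    rw [hS]; nlinarith [hrsq]
  rw [fderiv_radius_apply hz, h1, h2, hSval]
  have hr0 : radius a z ≠ 0 := hz.ne'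
  field_simp
  nlinarith [hrsq]

/-- **On the axis, a non-zero null vector tangent to the cylinder has non-zero energy.** At an
axis point with `r > r₊` (so `1 − 2H = Δ/(r² + a²) > 0`): tangency forces `w³ = 0`, then
`E = (1 − 2H) w⁰` and `g(w,w) = −(1 − 2H)(w⁰)² + (w¹)² + (w²)²`, so `E = 0` would force `w = 0`.
[folklore] -/
theorem ksEnergy_ne_zero_of_axis (ha : |a| ≤ M) (hr : 0 < radius a z)
    (hz : rPlus M a < radius a z) (h1 : z 1 = 0) (h2 : z 2 = 0) {w : E4} (hw : w ≠ 0)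
    (hnull : Kerr.bilin M a z w w = 0) (htan : fderiv ℝ (radius a) z w = 0) :
    ksEnergy M a z w ≠ 0 := by
  have hΔ : 0 < radius a z ^ 2 - 2 * M * radius a z + a ^ 2 := Ingoing.delta_pos_of_rPlus_lt ha hz
  have hrabs := radius_of_axis (a := a) h1 h2
  have hz3 : z 3 ≠ 0 := by
    intro h0; rw [h0, abs_zero] at hrabs; exact hr.ne' hrabs
  have hrsq : radius a z ^ 2 = z 3 ^ 2 := by rw [hrabs, sq_abs]
  -- tangency: `w³ = 0`
  have hw3 : w 3 = 0 := by
    rw [fderiv_radius_apply_of_axis hr h1 h2] at htan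
    rcases mul_eq_zero.1 htan with h | h
    · exact absurd (div_eq_zero_iff.1 h) (by push Not; exact ⟨hz3, hr.ne'⟩)
    · exact h
  -- the scalar `H` on the axis and `1 − 2H > 0`
  have hH : scalarH M a z = M * radius a z / (radius a z ^ 2 + a ^ 2) := by
    unfold scalarH
    rw [← hrsq]
    have : radius a z ≠ 0 := hr.ne'
    field_simp
  have h12H : 0 < 1 - 2 * scalarH M a z := by
    have hden : 0 < radius a z ^ 2 + a ^ 2 := by positivity
    have : 1 - 2 * scalarH M a z =
        (radius a z ^ 2 - 2 * M * radius a z + a ^ 2) / (radius a z ^ 2 + a ^ 2) := by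
      rw [hH]; field_simp; ring
    rw [this]
    exact div_pos hΔ hden
  intro hE
  unfold ksEnergy at hE
  have e1 : ((0 : Fin 3).succ : Fin 4) = 1 := rfl
  have e2 : ((1 : Fin 3).succ : Fin 4) = 2 := rfl
  have e3 : ((2 : Fin 3).succ : Fin 4) = 3 := rfl
  simp only [Kerr.bilin_apply, nullCovector_apply_of_axis h1 h2, Minkowski.bilin_apply,
    Fin.sum_univ_three, e1, e2, e3, Ingoing.bv_apply, Fin.isValue, Fin.reduceEq, if_true, if_false,
    hw3] at hE hnull
  norm_num at hE hnull
  -- `hE : (1 − 2H) w⁰ = 0`, `hnull : −(w⁰)² + (w¹)² + (w²)² + 2H (w⁰)² = 0`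
  have hw0 : w 0 = 0 := by
    have : (1 - 2 * scalarH M a z) * w 0 = 0 := by linarith
    rcases mul_eq_zero.1 this with h | h
    · exact absurd h h12H.ne'
    · exact h
  rw [hw0] at hnull
  have hw1 : w 1 = 0 := by nlinarith [sq_nonneg (w 1), sq_nonneg (w 2)]
  have hw2 : w 2 = 0 := by nlinarith [sq_nonneg (w 1), sq_nonneg (w 2)]
  apply hw
  ext i
  fin_cases i
  · exact hw0
  · exact hw1
  · exact hw2
  · exact hw3

end Axis

/-! ### The dichotomy at every point -/

/-- **Inward bending below the inner photon orbit, at every point (Kerr–Schild coordinates).**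
In sub-extremal Kerr (`0 < M`, `|a| < M`), at every point `z` of ingoing Kerr–Schild coordinate
space with `r₊ < r(z) < r_ph⁺ = photonOrbitRadius M (−|a|)` — symmetry axis included — every
non-zero vector `w` null for `g_{M,a}` and tangent to the cylinder `{r = r(z)}` has
`Hess r (w, w) < 0`: the cylinders are strongly null pseudo-convex towards `{r < c}`
(Ionescu–Klainerman, Def. 1.1). Off the axis this is `hessAt_radius_neg_of_offAxis`; on the axis
`2Σ² Hess r(w,w) = R′(r; E, 0, Q)` with `R = 0`, `E ≠ 0`, `Q = E²((r²+a²)²/Δ − a²) ≥ 0`, and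
`Kerr.deriv_nullRadialPotential_neg_of_lt_photonOrbitRadius_neg` applies.
[cite: IonescuKlainerman2012, Def. 1.1] -/
theorem hessAt_radius_neg (hM : 0 < M) (ha : |a| < M) {z : E4} (hz₁ : rPlus M a < radius a z)
    (hz₂ : radius a z < photonOrbitRadius M (-|a|)) {w : E4} (hw : w ≠ 0)
    (hnull : Kerr.bilin M a z w w = 0) (htan : fderiv ℝ (radius a) z w = 0) :
    hessAt (Kerr.bilin M a) (radius a) z w w < 0 := by
  by_cases hoff : z 1 ≠ 0 ∨ z 2 ≠ 0
  · exact hessAt_radius_neg_of_offAxis hM ha hz₁ hz₂ hoff hw hnull htan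
  push Not at hoff
  obtain ⟨h1, h2⟩ := hoff
  have hrp : 0 < rPlus M a := by
    have : M ≤ rPlus M a := by unfold rPlus; linarith [Real.sqrt_nonneg (M ^ 2 - a ^ 2)]
    linarith
  have hr : 0 < radius a z := hrp.trans hz₁
  have hΔ : 0 < radius a z ^ 2 - 2 * M * radius a z + a ^ 2 :=
    Ingoing.delta_pos_of_rPlus_lt ha.le hz₁
  have hS : 0 < blSigma a (E4.spatial z) := blSigma_spatial_pos hr
  set E := ksEnergy M a z w with hEdef
  set L := ksAngMom M a z w with hLdef
  set Q := ksCarterQ M a z w with hQdef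
  have hL0 : L = 0 := ksAngMom_of_axis h1 h2 w
  have hE0 : E ≠ 0 := ksEnergy_ne_zero_of_axis ha.le hr hz₁ h1 h2 hw hnull htan
  have hroot : nullRadialPotential M a E L Q (radius a z) = 0 :=
    nullRadialPotential_ksCarterQ_eq_zero hΔ.ne' w
  have hadm : NullThetaAdmissible a E L Q := by
    refine ⟨0, by norm_num, ?_⟩
    have hQ : 0 ≤ Q := by
      rw [hQdef]
      unfold ksCarterQ
      rw [← hEdef, ← hLdef, hL0]
      rw [sub_nonneg, le_div_iff₀ hΔ]
      have hr0 := hr.le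
      have key : (E * (radius a z ^ 2 + a ^ 2) - a * 0) ^ 2 -
          (0 - a * E) ^ 2 * (radius a z ^ 2 - 2 * M * radius a z + a ^ 2) =
          E ^ 2 * (radius a z ^ 4 + a ^ 2 * radius a z ^ 2 + 2 * M * a ^ 2 * radius a z) := by
        ring
      have hnn : 0 ≤ E ^ 2 * (radius a z ^ 4 + a ^ 2 * radius a z ^ 2 + 2 * M * a ^ 2 * radius a z) :=
        mul_nonneg (sq_nonneg E) (add_nonneg (add_nonneg (by positivity) (by positivity))
          (mul_nonneg (mul_nonneg (mul_nonneg zero_le_two hM.le) (sq_nonneg a)) hr0))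
      linarith [key, hnn]
    simpa using hQ
  have hne : E ≠ 0 ∨ L ≠ 0 ∨ Q ≠ 0 := Or.inl hE0
  have hd : deriv (nullRadialPotential M a E L Q) (radius a z) < 0 :=
    deriv_nullRadialPotential_neg_of_lt_photonOrbitRadius_neg hM ha hz₁ hz₂ hadm hne hroot
  have hid := two_mul_sq_blSigma_mul_hessAt_eq_deriv (M := M) hr hΔ.ne' hnull htan
  rw [← hEdef, ← hLdef, ← hQdef] at hid
  have : 2 * blSigma a (E4.spatial z) ^ 2 * hessAt (Kerr.bilin M a) (radius a) z w w < 0 := by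
    rw [hid]; exact hd
  have h2S : 0 < 2 * blSigma a (E4.spatial z) ^ 2 := by positivity
  nlinarith

/-- **Outward bending beyond the outer photon orbit, at every point (Kerr–Schild coordinates).**
In sub-extremal Kerr, at every point with `r(z) > r_ph⁻ = photonOrbitRadius M |a|` — axis
included — every non-zero null vector tangent to `{r = r(z)}` has `Hess r (w, w) > 0`: the
cylinders are strongly null pseudo-convex towards `{r > c}` (Ionescu–Klainerman, Def. 1.1).
[cite: IonescuKlainerman2012, Def. 1.1] -/
theorem hessAt_radius_pos (hM : 0 < M) (ha : |a| < M) {z : E4}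
    (hz : photonOrbitRadius M |a| < radius a z) {w : E4} (hw : w ≠ 0)
    (hnull : Kerr.bilin M a z w w = 0) (htan : fderiv ℝ (radius a) z w = 0) :
    0 < hessAt (Kerr.bilin M a) (radius a) z w w := by
  by_cases hoff : z 1 ≠ 0 ∨ z 2 ≠ 0
  · exact hessAt_radius_pos_of_offAxis hM ha hz hoff hw hnull htan
  push Not at hoff
  obtain ⟨h1, h2⟩ := hoff
  have h3 : 3 * M ≤ photonOrbitRadius M |a| := (photonOrbitRadius_mem hM (abs_nonneg a)).1
  have hz₁ : rPlus M a < radius a z := by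
    have h2M : rPlus M a ≤ 2 * M := by
      have hMa : 0 ≤ M ^ 2 - a ^ 2 := by nlinarith [abs_nonneg a, sq_abs a]
      have : √(M ^ 2 - a ^ 2) ≤ M := by
        rw [Real.sqrt_le_left hM.le]; nlinarith
      unfold rPlus; linarith
    linarith
  have hrp : 0 < rPlus M a := by
    have : M ≤ rPlus M a := by unfold rPlus; linarith [Real.sqrt_nonneg (M ^ 2 - a ^ 2)]
    linarith
  have hr : 0 < radius a z := hrp.trans hz₁
  have hΔ : 0 < radius a z ^ 2 - 2 * M * radius a z + a ^ 2 :=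
    Ingoing.delta_pos_of_rPlus_lt ha.le hz₁
  have hS : 0 < blSigma a (E4.spatial z) := blSigma_spatial_pos hr
  set E := ksEnergy M a z w with hEdef
  set L := ksAngMom M a z w with hLdef
  set Q := ksCarterQ M a z w with hQdef
  have hL0 : L = 0 := ksAngMom_of_axis h1 h2 w
  have hE0 : E ≠ 0 := ksEnergy_ne_zero_of_axis ha.le hr hz₁ h1 h2 hw hnull htan
  have hroot : nullRadialPotential M a E L Q (radius a z) = 0 :=
    nullRadialPotential_ksCarterQ_eq_zero hΔ.ne' w
  have hadm : NullThetaAdmissible a E L Q := by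
    refine ⟨0, by norm_num, ?_⟩
    have hQ : 0 ≤ Q := by
      rw [hQdef]
      unfold ksCarterQ
      rw [← hEdef, ← hLdef, hL0]
      rw [sub_nonneg, le_div_iff₀ hΔ]
      have hr0 := hr.le
      have key : (E * (radius a z ^ 2 + a ^ 2) - a * 0) ^ 2 -
          (0 - a * E) ^ 2 * (radius a z ^ 2 - 2 * M * radius a z + a ^ 2) =
          E ^ 2 * (radius a z ^ 4 + a ^ 2 * radius a z ^ 2 + 2 * M * a ^ 2 * radius a z) := by
        ring
      have hnn : 0 ≤ E ^ 2 * (radius a z ^ 4 + a ^ 2 * radius a z ^ 2 + 2 * M * a ^ 2 * radius a z) :=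
        mul_nonneg (sq_nonneg E) (add_nonneg (add_nonneg (by positivity) (by positivity))
          (mul_nonneg (mul_nonneg (mul_nonneg zero_le_two hM.le) (sq_nonneg a)) hr0))
      linarith [key, hnn]
    simpa using hQ
  have hne : E ≠ 0 ∨ L ≠ 0 ∨ Q ≠ 0 := Or.inl hE0
  have hd : 0 < deriv (nullRadialPotential M a E L Q) (radius a z) :=
    deriv_nullRadialPotential_pos_of_photonOrbitRadius_lt hM ha hz hadm hne hroot
  have hid := two_mul_sq_blSigma_mul_hessAt_eq_deriv (M := M) hr hΔ.ne' hnull htan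
  rw [← hEdef, ← hLdef, ← hQdef] at hid
  have : 0 < 2 * blSigma a (E4.spatial z) ^ 2 * hessAt (Kerr.bilin M a) (radius a) z w w := by
    rw [hid]; exact hd
  have h2S : 0 < 2 * blSigma a (E4.spatial z) ^ 2 := by positivity
  exact pos_of_mul_pos_right this h2S.le

end Kerr

end Literature.Geometry.Lorentzian

end
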